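import Mathlib
import Summits.ResolutionOfSingularities.ResolutionOfSingularities.Theorems.WildQuotientsWildQuotientResolutionJordanFiveI12Powers
import Summits.ResolutionOfSingularities.ResolutionOfSingularities.Theorems.WildQuotientsWildQuotientResolutionJordanFiveUEight
import Summits.ResolutionOfSingularities.ResolutionOfSingularities.Theorems.WildQuotientsWildQuotientResolutionJordanFiveI12Stable

/-!
# RUNG V5 (J₅) — weight lower bounds of the invariants and the `I₁₂^μ`-memberships of the inverse dictionary

(crux stmt-ResolutionOfSingularities-15640 `WildQuotients.WildQuotientResolution`, line `Sketch`;
chain w45c RUNG V5 HP₁ (res-L1-w45c-plan-1 NAMED 2026-08-27T11:35:13Z: stub-1 = the T2-analogue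
`eE`). Uses this seat's `…JordanFiveI12Powers` (p529243: `mem_I12_pow_of_forall_le_weight`) over
res-L1-w45c-lead-1's `JordanFive.weight n a b c d` (p523816) and the `JordanFour.lb_*` calculus
(p502667). [OURS · L1 W4.5c] — NOT a statement of any manuscript (Hironaka 2017 is consumed nowhere);
replaces the role of no printed item. Prover res-L1-w45c-stub-1. AI-written Lean, kernel-checked;
weaker than expert review.)

The inverse dictionary of the universal twisted chart at the `μ₃`-vertex (RT-J5 §4; STATUS
2026-08-27T11:17:53Z) reads each cubic generator `t` as `ψ₅(F)·Q^{e′}/((l¹²Q²)^μ Q^e)` with a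
NUMERATOR `F ∈ I₁₂^μ`:
`l³ ← T′H′ (1)`, `l²ξ ← MT′ (1)`, `lξ² ← M²T′H′ (2)`, `ξ³ ← M³T′ (2)`, `lA ← x_aT′ (1)`,
`ξA ← x_aMT′H′ (2)`, `lη₁ ← Δ₇H′ (2)`, `ξη₁ ← MΔ₇ (2)`, `A³ ← x_a³ (1)`, `A²η₁ ← x_a²Δ₇T′ (3)`,
`Aη₁² ← x_aΔ₇²H′ (4)`, `η₁³ ← Δ₇³T′H′ (6)`, `η₂ ← U₈/24 (2)`.
This file proves all thirteen memberships from WEIGHTS (res-L1-w45c-lead-1's `JordanFive.weight_eq`,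
p529341): the lower bounds `lb_hPrime (6)`, `lb_tPrime (9)`, `lb_mSlice (5)`,
`lb_iTwo (4)`, `lb_jThreeTwo (6)`, `lb_delta7 (19)` (through `x_a²Δ₇ = T′H′³ − T′³ + 3x_aT′²H′` and
the shift lemma `lb_of_lb_X_pow_mul`), `lb_uEight (24)`, and `mem_I12_pow_of_lb`.
-/

-- single-problem summit: the doubled namespace component `ResolutionOfSingularities` is forced
set_option linter.dupNamespace false

noncomputable section

open MvPolynomial

namespace Summit.ResolutionOfSingularities.ResolutionOfSingularities.Theorems.WildQuotientResolution.JordanFive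

variable (k : Type) [Field k] (n : ℕ) (a b c d e : Fin n)
  (hab : a ≠ b) (hac : a ≠ c) (had : a ≠ d) (hae : a ≠ e) (hbc : b ≠ c) (hbd : b ≠ d) (hbe : b ≠ e)
  (hcd : c ≠ d) (hce : c ≠ e) (hde : d ≠ e)

local notation3 "W" => JordanFive.weight n a b c d

/-! ### The weight of record and the bridge to `I₁₂^N` -/

/-- `weight a = 4`. [folklore] -/
theorem weight_a : JordanFive.weight n a b c d a = 4 := by simp [JordanFive.weight]

include hab in
/-- `weight b = 3`. [folklore] -/
theorem weight_b : JordanFive.weight n a b c d b = 3 := by simp [JordanFive.weight, hab.symm]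

include hac hbc in
/-- `weight c = 2`. [folklore] -/
theorem weight_c : JordanFive.weight n a b c d c = 2 := by simp [JordanFive.weight, hac.symm, hbc.symm]

include had hbd hcd in
/-- `weight d = 1`. [folklore] -/
theorem weight_d : JordanFive.weight n a b c d d = 1 := by
  simp [JordanFive.weight, had.symm, hbd.symm, hcd.symm]

/-- `weight i = 0` off `{a,b,c,d}`. [folklore] -/
theorem weight_of_ne (i : Fin n) (hia : i ≠ a) (hib : i ≠ b) (hic : i ≠ c) (hid : i ≠ d) :
    JordanFive.weight n a b c d i = 0 := by simp [JordanFive.weight, hia, hib, hic, hid]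

include hab hac had hbc hbd hcd in
/-- **`F ∈ I₁₂^N` as soon as every monomial of `F` has weight `≥ 12N`** (weight-of-record form of
`mem_I12_pow_of_forall_le_weight`). [OURS · L1 W4.5c] -/
theorem mem_I12_pow_of_lb (N : ℕ) (F : MvPolynomial (Fin n) k)
    (hF : ∀ e', coeff e' F ≠ 0 → 12 * N ≤ Finsupp.weight (JordanFive.weight n a b c d) e') :
    F ∈ I12 k n a b c d ^ N :=
  mem_I12_pow_of_forall_le_weight k n a b c d hab hac had hbc hbd hcd N F fun e' he' => by
    have h := hF e' he'; rwa [JordanFive.weight_eq n a b c d hab hac had hbc hbd hcd] at h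

/-! ### Lower weight bounds -/

/-- Any left multiple keeps a lower weight bound. [folklore] -/
theorem lb_mul_left (w : Fin n → ℕ) {v : ℕ} (g : MvPolynomial (Fin n) k) {f : MvPolynomial (Fin n) k}
    (hf : ∀ e', coeff e' f ≠ 0 → v ≤ Finsupp.weight w e') :
    ∀ e', coeff e' (g * f) ≠ 0 → v ≤ Finsupp.weight w e' := by
  have h := JordanFour.lb_mul w (fun e' (_ : coeff e' g ≠ 0) => Nat.zero_le (Finsupp.weight w e')) hf
  rwa [zero_add] at h

/-- **Shift lemma**: a lower bound `v + m·w(i)` for `X i ^ m * F` gives the lower bound `v` for `F`.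
[folklore] -/
theorem lb_of_lb_X_pow_mul (w : Fin n → ℕ) {v : ℕ} (i : Fin n) (m : ℕ) {F : MvPolynomial (Fin n) k}
    (hF : ∀ e', coeff e' (X i ^ m * F) ≠ 0 → v + m * w i ≤ Finsupp.weight w e') :
    ∀ e', coeff e' F ≠ 0 → v ≤ Finsupp.weight w e' := by
  classical
  intro e' he'
  have h1 : coeff (e' + Finsupp.single i m) (X i ^ m * F) = coeff e' F := by
    rw [X_pow_eq_monomial, coeff_monomial_mul', if_pos le_add_self, one_mul, add_tsub_cancel_right]
  have h2 := hF (e' + Finsupp.single i m) (by rw [h1]; exact he')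
  rw [map_add, Finsupp.weight_apply (f := Finsupp.single i m), Finsupp.sum_single_index (by simp),
    smul_eq_mul] at h2
  omega

section Bounds

include hab hac hbc in
/-- `H′` has weight `≥ 6`. [OURS · L1 W4.5c] -/
theorem lb_hPrime : ∀ e', coeff e' (JordanFour.hPrime k n a b c) ≠ 0 → 6 ≤ Finsupp.weight W e' := by
  have hXa : IsWeightedHomogeneous W (X a : MvPolynomial (Fin n) k) 4 :=
    weight_a n a b c d ▸ isWeightedHomogeneous_X k W a
  have hXb : IsWeightedHomogeneous W (X b : MvPolynomial (Fin n) k) 3 :=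
    weight_b n a b c d hab ▸ isWeightedHomogeneous_X k W b
  have hXc : IsWeightedHomogeneous W (X c : MvPolynomial (Fin n) k) 2 :=
    weight_c n a b c d hac hbc ▸ isWeightedHomogeneous_X k W c
  unfold JordanFour.hPrime
  exact (JordanFour.lb_sub W (JordanFour.lb_sub W (JordanFour.lb_of_isWeightedHomogeneous W (hXb.pow 2) (by norm_num)) (JordanFour.lb_of_isWeightedHomogeneous W (hXa.mul hXb) (by norm_num))) (lb_mul_left k n W _ (JordanFour.lb_of_isWeightedHomogeneous W (hXa.mul hXc) (by norm_num))))

include hab hac had hbc hbd hcd in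
/-- `T′` has weight `≥ 9`. [OURS · L1 W4.5c] -/
theorem lb_tPrime : ∀ e', coeff e' (JordanFour.tPrime k n a b c d) ≠ 0 → 9 ≤ Finsupp.weight W e' := by
  have hXa : IsWeightedHomogeneous W (X a : MvPolynomial (Fin n) k) 4 :=
    weight_a n a b c d ▸ isWeightedHomogeneous_X k W a
  have hXb : IsWeightedHomogeneous W (X b : MvPolynomial (Fin n) k) 3 :=
    weight_b n a b c d hab ▸ isWeightedHomogeneous_X k W b
  have hXc : IsWeightedHomogeneous W (X c : MvPolynomial (Fin n) k) 2 :=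
    weight_c n a b c d hac hbc ▸ isWeightedHomogeneous_X k W c
  have hXd : IsWeightedHomogeneous W (X d : MvPolynomial (Fin n) k) 1 :=
    weight_d n a b c d had hbd hcd ▸ isWeightedHomogeneous_X k W d
  unfold JordanFour.tPrime
  exact (JordanFour.lb_sub W (JordanFour.lb_add W (JordanFour.lb_sub W (JordanFour.lb_of_isWeightedHomogeneous W (hXb.pow 3) (by norm_num)) (lb_mul_left k n W _ (JordanFour.lb_of_isWeightedHomogeneous W ((hXa.mul hXb).mul hXc) (by norm_num)))) (lb_mul_left k n W _ (JordanFour.lb_of_isWeightedHomogeneous W ((hXa.pow 2).mul hXd) (by norm_num)))) (JordanFour.lb_of_isWeightedHomogeneous W ((hXa.pow 2).mul hXb) (by norm_num)))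

include hab hac had hbc hbd hcd in
/-- `M` has weight `≥ 5`. [OURS · L1 W4.5c] -/
theorem lb_mSlice : ∀ e', coeff e' (JordanFour.mSlice k n a b c d) ≠ 0 → 5 ≤ Finsupp.weight W e' := by
  have hXa : IsWeightedHomogeneous W (X a : MvPolynomial (Fin n) k) 4 :=
    weight_a n a b c d ▸ isWeightedHomogeneous_X k W a
  have hXb : IsWeightedHomogeneous W (X b : MvPolynomial (Fin n) k) 3 :=
    weight_b n a b c d hab ▸ isWeightedHomogeneous_X k W b
  have hXc : IsWeightedHomogeneous W (X c : MvPolynomial (Fin n) k) 2 :=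
    weight_c n a b c d hac hbc ▸ isWeightedHomogeneous_X k W c
  have hXd : IsWeightedHomogeneous W (X d : MvPolynomial (Fin n) k) 1 :=
    weight_d n a b c d had hbd hcd ▸ isWeightedHomogeneous_X k W d
  unfold JordanFour.mSlice
  exact (JordanFour.lb_sub W (JordanFour.lb_add W (JordanFour.lb_sub W (JordanFour.lb_of_isWeightedHomogeneous W (hXb.mul hXc) (by norm_num)) (JordanFour.lb_of_isWeightedHomogeneous W (hXb.pow 2) (by norm_num))) (JordanFour.lb_of_isWeightedHomogeneous W (hXa.mul hXb) (by norm_num))) (lb_mul_left k n W _ (JordanFour.lb_of_isWeightedHomogeneous W (hXa.mul hXd) (by norm_num))))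

include hab hac had hbc hbd hcd in
/-- `Δ₇` has weight `≥ 19` (through `x_a²Δ₇ = T′H′³ − T′³ + 3x_aT′²H′`, weight `≥ 27`).
[OURS · L1 W4.5c] -/
theorem lb_delta7 : ∀ e', coeff e' (JordanFour.delta7 k n a b c d) ≠ 0 → 19 ≤ Finsupp.weight W e' := by
  have hH := lb_hPrime k n a b c d hab hac hbc
  have hT := lb_tPrime k n a b c d hab hac had hbc hbd hcd
  have hXa : IsWeightedHomogeneous W (X a : MvPolynomial (Fin n) k) 4 :=
    weight_a n a b c d ▸ isWeightedHomogeneous_X k W a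
  refine lb_of_lb_X_pow_mul k n W a 2 (F := JordanFour.delta7 k n a b c d) ?_
  rw [weight_a, JordanFour.X_a_sq_mul_delta7]
  refine JordanFour.lb_add W (JordanFour.lb_sub W ?_ ?_) ?_
  · exact JordanFour.lb_mono W (by norm_num) (JordanFour.lb_mul W hT (JordanFour.lb_pow W hH 3))
  · exact JordanFour.lb_mono W (by norm_num) (JordanFour.lb_pow W hT 3)
  · have h := JordanFour.lb_mul W (JordanFour.lb_mul W
      (lb_mul_left k n W (3 : MvPolynomial (Fin n) k) (JordanFour.lb_of_isWeightedHomogeneous W hXa le_rfl))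
      (JordanFour.lb_pow W hT 2)) hH
    exact JordanFour.lb_mono W (by norm_num) h

include hab hac had hae hbc hbd hbe hcd hce hde in
/-- `i₂` has weight `≥ 4`. [OURS · L1 W4.5c] -/
theorem lb_iTwo : ∀ e', coeff e' (iTwo k n a b c d e) ≠ 0 → 4 ≤ Finsupp.weight W e' := by
  have hXa : IsWeightedHomogeneous W (X a : MvPolynomial (Fin n) k) 4 :=
    weight_a n a b c d ▸ isWeightedHomogeneous_X k W a
  have hXb : IsWeightedHomogeneous W (X b : MvPolynomial (Fin n) k) 3 :=
    weight_b n a b c d hab ▸ isWeightedHomogeneous_X k W b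
  have hXc : IsWeightedHomogeneous W (X c : MvPolynomial (Fin n) k) 2 :=
    weight_c n a b c d hac hbc ▸ isWeightedHomogeneous_X k W c
  have hXd : IsWeightedHomogeneous W (X d : MvPolynomial (Fin n) k) 1 :=
    weight_d n a b c d had hbd hcd ▸ isWeightedHomogeneous_X k W d
  have hXe : IsWeightedHomogeneous W (X e : MvPolynomial (Fin n) k) 0 :=
    weight_of_ne n a b c d e hae.symm hbe.symm hce.symm hde.symm ▸ isWeightedHomogeneous_X k W e
  unfold iTwo
  exact (JordanFour.lb_add W (JordanFour.lb_add W (JordanFour.lb_add W (JordanFour.lb_sub W (JordanFour.lb_sub W (JordanFour.lb_of_isWeightedHomogeneous W (hXc.pow 2) (by norm_num)) (JordanFour.lb_of_isWeightedHomogeneous W (hXb.mul hXc) (by norm_num))) (lb_mul_left k n W _ (JordanFour.lb_of_isWeightedHomogeneous W (hXb.mul hXd) (by norm_num)))) (JordanFour.lb_of_isWeightedHomogeneous W (hXa.mul hXc) (by norm_num))) (lb_mul_left k n W _ (JordanFour.lb_of_isWeightedHomogeneous W (hXa.mul hXd) (by norm_num)))) (lb_mul_left k n W _ (JordanFour.lb_of_isWeightedHomogeneous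 W (hXa.mul hXe) (by norm_num))))

include hab hac had hae hbc hbd hbe hcd hce hde in
/-- `2j₃` has weight `≥ 6`. [OURS · L1 W4.5c] -/
theorem lb_jThreeTwo : ∀ e', coeff e' (jThreeTwo k n a b c d e) ≠ 0 → 6 ≤ Finsupp.weight W e' := by
  have hXa : IsWeightedHomogeneous W (X a : MvPolynomial (Fin n) k) 4 :=
    weight_a n a b c d ▸ isWeightedHomogeneous_X k W a
  have hXb : IsWeightedHomogeneous W (X b : MvPolynomial (Fin n) k) 3 :=
    weight_b n a b c d hab ▸ isWeightedHomogeneous_X k W b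
  have hXc : IsWeightedHomogeneous W (X c : MvPolynomial (Fin n) k) 2 :=
    weight_c n a b c d hac hbc ▸ isWeightedHomogeneous_X k W c
  have hXd : IsWeightedHomogeneous W (X d : MvPolynomial (Fin n) k) 1 :=
    weight_d n a b c d had hbd hcd ▸ isWeightedHomogeneous_X k W d
  have hXe : IsWeightedHomogeneous W (X e : MvPolynomial (Fin n) k) 0 :=
    weight_of_ne n a b c d e hae.symm hbe.symm hce.symm hde.symm ▸ isWeightedHomogeneous_X k W e
  unfold jThreeTwo
  exact (JordanFour.lb_sub W (JordanFour.lb_add W (JordanFour.lb_add W (JordanFour.lb_sub W (JordanFour.lb_sub W (JordanFour.lb_sub W (JordanFour.lb_sub W (JordanFour.lb_add W (JordanFour.lb_sub W (JordanFour.lb_add W (JordanFour.lb_add W (JordanFour.lb_of_isWeightedHomogeneous W ((hXa.mul hXb).mul hXc) (by norm_num)) (lb_mul_left k n W _ (JordanFour.lb_of_isWeightedHomogeneous W ((hXa.mul hXb).mul hXd) (by norm_num)))) (lb_mul_left k n W _ (JordanFour.lb_of_isWeightedHomogeneous W ((hXa.mul hXb).mul hXe) (by norm_num)))) (lb_mul_left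 k n W _ (JordanFour.lb_of_isWeightedHomogeneous W (hXa.mul (hXc.pow 2)) (by norm_num)))) (lb_mul_left k n W _ (JordanFour.lb_of_isWeightedHomogeneous W ((hXa.mul hXc).mul hXe) (by norm_num)))) (lb_mul_left k n W _ (JordanFour.lb_of_isWeightedHomogeneous W (hXa.mul (hXd.pow 2)) (by norm_num)))) (JordanFour.lb_of_isWeightedHomogeneous W ((hXb.pow 2).mul hXc) (by norm_num))) (lb_mul_left k n W _ (JordanFour.lb_of_isWeightedHomogeneous W ((hXb.pow 2).mul hXd) (by norm_num)))) (lb_mul_left k n W _ (JordanFour.lb_of_isWeightedHomogeneous W ((hXb.pow 2).mul hXe) (by norm_num)))) (lb_mul_left k n W _ (JordanFour.lb_of_isWeightedHomogeneous W (hXb.mul (hXc.pow 2)) (by norm_num)))) (lb_mul_left k n W _ (JordanFour.lb_of_isWeightedHomogeneous W ((hXb.mul hXc).mul hXd) (by norm_num)))) (lb_mul_left k n W _ (JordanFour.lb_of_isWeightedHomogeneous W (hXc.pow 3) (by norm_num))))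

include hab hac had hae hbc hbd hbe hcd hce hde in
/-- **`U₈` has weight `≥ 24`.** [OURS · L1 W4.5c] -/
theorem lb_uEight : ∀ e', coeff e' (uEight k n a b c d e) ≠ 0 → 24 ≤ Finsupp.weight W e' := by
  have hH := lb_hPrime k n a b c d hab hac hbc
  have hT := lb_tPrime k n a b c d hab hac had hbc hbd hcd
  have hD := lb_delta7 k n a b c d hab hac had hbc hbd hcd
  have hI := lb_iTwo k n a b c d e hab hac had hae hbc hbd hbe hcd hce hde
  have hJ := lb_jThreeTwo k n a b c d e hab hac had hae hbc hbd hbe hcd hce hde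
  have hXa : IsWeightedHomogeneous W (X a : MvPolynomial (Fin n) k) 4 :=
    weight_a n a b c d ▸ isWeightedHomogeneous_X k W a
  have hA : ∀ e', coeff e' (X a : MvPolynomial (Fin n) k) ≠ 0 → 4 ≤ Finsupp.weight W e' :=
    JordanFour.lb_of_isWeightedHomogeneous W hXa le_rfl
  unfold uEight
  refine JordanFour.lb_add W (JordanFour.lb_add W (JordanFour.lb_add W (JordanFour.lb_sub W
    (JordanFour.lb_sub W (JordanFour.lb_sub W (JordanFour.lb_add W ?_ ?_) ?_) ?_) ?_) ?_) ?_) ?_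
  · exact JordanFour.lb_neg W (JordanFour.lb_mono W (by norm_num)
      (JordanFour.lb_mul W (JordanFour.lb_pow W hT 2) hJ))
  · exact lb_mul_left k n W _ (JordanFour.lb_mono W (by norm_num) (JordanFour.lb_mul W hH hD))
  · exact lb_mul_left k n W _ (JordanFour.lb_mono W (by norm_num)
      (JordanFour.lb_mul W (JordanFour.lb_mul W (JordanFour.lb_pow W hH 2) hI) hT))
  · exact lb_mul_left k n W _ (JordanFour.lb_mono W (by norm_num)
      (JordanFour.lb_mul W (JordanFour.lb_pow W hH 3) hJ))
  · exact lb_mul_left k n W _ (JordanFour.lb_mono W (by norm_num)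
      (JordanFour.lb_mul W (JordanFour.lb_pow W hH 3) hT))
  · exact lb_mul_left k n W _ (JordanFour.lb_mono W (by norm_num)
      (JordanFour.lb_mul W (JordanFour.lb_mul W hA (JordanFour.lb_pow W hH 2)) (JordanFour.lb_pow W hI 2)))
  · exact lb_mul_left k n W _ (JordanFour.lb_mono W (by norm_num)
      (JordanFour.lb_mul W (JordanFour.lb_mul W hA (JordanFour.lb_pow W hH 3)) hI))
  · exact lb_mul_left k n W _ (JordanFour.lb_mono W (by norm_num)
      (JordanFour.lb_mul W (JordanFour.lb_mul W (JordanFour.lb_mul W (JordanFour.lb_pow W hA 2) hH) hI) hJ))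

end Bounds

/-! ### The thirteen dictionary numerators lie in the right powers of `I₁₂` -/

section Memberships

include hab hac had hbc hbd hcd

/-- `T′H′ ∈ I₁₂` (weight `15`). [OURS · L1 W4.5c] -/
theorem tPrime_mul_hPrime_mem :
    JordanFour.tPrime k n a b c d * JordanFour.hPrime k n a b c ∈ I12 k n a b c d := by
  have h := mem_I12_pow_of_lb k n a b c d hab hac had hbc hbd hcd 1 _ (JordanFour.lb_mono W (by norm_num)
    (JordanFour.lb_mul W (lb_tPrime k n a b c d hab hac had hbc hbd hcd) (lb_hPrime k n a b c d hab hac hbc)))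
  rwa [pow_one] at h

/-- `MT′ ∈ I₁₂` (weight `14`). [OURS · L1 W4.5c] -/
theorem mSlice_mul_tPrime_mem :
    JordanFour.mSlice k n a b c d * JordanFour.tPrime k n a b c d ∈ I12 k n a b c d := by
  have h := mem_I12_pow_of_lb k n a b c d hab hac had hbc hbd hcd 1 _ (JordanFour.lb_mono W (by norm_num)
    (JordanFour.lb_mul W (lb_mSlice k n a b c d hab hac had hbc hbd hcd) (lb_tPrime k n a b c d hab hac had hbc hbd hcd)))
  rwa [pow_one] at h

/-- `M²T′H′ ∈ I₁₂²` (weight `25`). [OURS · L1 W4.5c] -/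
theorem mSlice_sq_mul_tPrime_mul_hPrime_mem :
    JordanFour.mSlice k n a b c d ^ 2 * JordanFour.tPrime k n a b c d * JordanFour.hPrime k n a b c ∈
      I12 k n a b c d ^ 2 :=
  mem_I12_pow_of_lb k n a b c d hab hac had hbc hbd hcd 2 _ (JordanFour.lb_mono W (by norm_num)
    (JordanFour.lb_mul W (JordanFour.lb_mul W (JordanFour.lb_pow W (lb_mSlice k n a b c d hab hac had hbc hbd hcd) 2)
      (lb_tPrime k n a b c d hab hac had hbc hbd hcd)) (lb_hPrime k n a b c d hab hac hbc)))

/-- `M³T′ ∈ I₁₂²` (weight `24`). [OURS · L1 W4.5c] -/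
theorem mSlice_cube_mul_tPrime_mem :
    JordanFour.mSlice k n a b c d ^ 3 * JordanFour.tPrime k n a b c d ∈ I12 k n a b c d ^ 2 :=
  mem_I12_pow_of_lb k n a b c d hab hac had hbc hbd hcd 2 _ (JordanFour.lb_mono W (by norm_num)
    (JordanFour.lb_mul W (JordanFour.lb_pow W (lb_mSlice k n a b c d hab hac had hbc hbd hcd) 3)
      (lb_tPrime k n a b c d hab hac had hbc hbd hcd)))

/-- `x_aT′ ∈ I₁₂` (weight `13`). [OURS · L1 W4.5c] -/
theorem X_a_mul_tPrime_mem : X a * JordanFour.tPrime k n a b c d ∈ I12 k n a b c d := by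
  have hXa : IsWeightedHomogeneous W (X a : MvPolynomial (Fin n) k) 4 :=
    weight_a n a b c d ▸ isWeightedHomogeneous_X k W a
  have h := mem_I12_pow_of_lb k n a b c d hab hac had hbc hbd hcd 1 _ (JordanFour.lb_mono W (by norm_num)
    (JordanFour.lb_mul W (JordanFour.lb_of_isWeightedHomogeneous W hXa le_rfl)
      (lb_tPrime k n a b c d hab hac had hbc hbd hcd)))
  rwa [pow_one] at h

/-- `x_aMT′H′ ∈ I₁₂²` (weight `24`). [OURS · L1 W4.5c] -/
theorem X_a_mul_mSlice_mul_tPrime_mul_hPrime_mem :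
    X a * JordanFour.mSlice k n a b c d * JordanFour.tPrime k n a b c d * JordanFour.hPrime k n a b c ∈
      I12 k n a b c d ^ 2 := by
  have hXa : IsWeightedHomogeneous W (X a : MvPolynomial (Fin n) k) 4 :=
    weight_a n a b c d ▸ isWeightedHomogeneous_X k W a
  exact mem_I12_pow_of_lb k n a b c d hab hac had hbc hbd hcd 2 _ (JordanFour.lb_mono W (by norm_num)
    (JordanFour.lb_mul W (JordanFour.lb_mul W (JordanFour.lb_mul W
      (JordanFour.lb_of_isWeightedHomogeneous W hXa le_rfl) (lb_mSlice k n a b c d hab hac had hbc hbd hcd))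
      (lb_tPrime k n a b c d hab hac had hbc hbd hcd)) (lb_hPrime k n a b c d hab hac hbc)))

/-- `Δ₇H′ ∈ I₁₂²` (weight `25`). [OURS · L1 W4.5c] -/
theorem delta7_mul_hPrime_mem :
    JordanFour.delta7 k n a b c d * JordanFour.hPrime k n a b c ∈ I12 k n a b c d ^ 2 :=
  mem_I12_pow_of_lb k n a b c d hab hac had hbc hbd hcd 2 _ (JordanFour.lb_mono W (by norm_num)
    (JordanFour.lb_mul W (lb_delta7 k n a b c d hab hac had hbc hbd hcd) (lb_hPrime k n a b c d hab hac hbc)))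

/-- `MΔ₇ ∈ I₁₂²` (weight `24`). [OURS · L1 W4.5c] -/
theorem mSlice_mul_delta7_mem :
    JordanFour.mSlice k n a b c d * JordanFour.delta7 k n a b c d ∈ I12 k n a b c d ^ 2 :=
  mem_I12_pow_of_lb k n a b c d hab hac had hbc hbd hcd 2 _ (JordanFour.lb_mono W (by norm_num)
    (JordanFour.lb_mul W (lb_mSlice k n a b c d hab hac had hbc hbd hcd) (lb_delta7 k n a b c d hab hac had hbc hbd hcd)))

omit hab hac had hbc hbd hcd in
/-- `x_a³ ∈ I₁₂` (the generator `g₀`). [OURS · L1 W4.5c] -/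
theorem X_a_cube_mem : (X a ^ 3 : MvPolynomial (Fin n) k) ∈ I12 k n a b c d :=
  Ideal.subset_span ⟨0, rfl⟩

/-- `x_a²Δ₇T′ ∈ I₁₂³` (weight `36`). [OURS · L1 W4.5c] -/
theorem X_a_sq_mul_delta7_mul_tPrime_mem :
    X a ^ 2 * JordanFour.delta7 k n a b c d * JordanFour.tPrime k n a b c d ∈ I12 k n a b c d ^ 3 := by
  have hXa : IsWeightedHomogeneous W (X a : MvPolynomial (Fin n) k) 4 :=
    weight_a n a b c d ▸ isWeightedHomogeneous_X k W a
  exact mem_I12_pow_of_lb k n a b c d hab hac had hbc hbd hcd 3 _ (JordanFour.lb_mono W (by norm_num)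
    (JordanFour.lb_mul W (JordanFour.lb_mul W (JordanFour.lb_of_isWeightedHomogeneous W (hXa.pow 2) le_rfl)
      (lb_delta7 k n a b c d hab hac had hbc hbd hcd)) (lb_tPrime k n a b c d hab hac had hbc hbd hcd)))

/-- `x_aΔ₇²H′ ∈ I₁₂⁴` (weight `48`). [OURS · L1 W4.5c] -/
theorem X_a_mul_delta7_sq_mul_hPrime_mem :
    X a * JordanFour.delta7 k n a b c d ^ 2 * JordanFour.hPrime k n a b c ∈ I12 k n a b c d ^ 4 := by
  have hXa : IsWeightedHomogeneous W (X a : MvPolynomial (Fin n) k) 4 :=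
    weight_a n a b c d ▸ isWeightedHomogeneous_X k W a
  exact mem_I12_pow_of_lb k n a b c d hab hac had hbc hbd hcd 4 _ (JordanFour.lb_mono W (by norm_num)
    (JordanFour.lb_mul W (JordanFour.lb_mul W (JordanFour.lb_of_isWeightedHomogeneous W hXa le_rfl)
      (JordanFour.lb_pow W (lb_delta7 k n a b c d hab hac had hbc hbd hcd) 2))
      (lb_hPrime k n a b c d hab hac hbc)))

/-- `Δ₇³T′H′ ∈ I₁₂⁶` (weight `72`). [OURS · L1 W4.5c] -/
theorem delta7_cube_mul_tPrime_mul_hPrime_mem :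
    JordanFour.delta7 k n a b c d ^ 3 * JordanFour.tPrime k n a b c d * JordanFour.hPrime k n a b c ∈
      I12 k n a b c d ^ 6 :=
  mem_I12_pow_of_lb k n a b c d hab hac had hbc hbd hcd 6 _ (JordanFour.lb_mono W (by norm_num)
    (JordanFour.lb_mul W (JordanFour.lb_mul W (JordanFour.lb_pow W (lb_delta7 k n a b c d hab hac had hbc hbd hcd) 3)
      (lb_tPrime k n a b c d hab hac had hbc hbd hcd)) (lb_hPrime k n a b c d hab hac hbc)))

omit hab hac had hbc hbd hcd in
include hab hac had hae hbc hbd hbe hcd hce hde in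
/-- `r·U₈ ∈ I₁₂²` for any scalar `r` (weight `24`; `r = 1/24` in the dictionary). [OURS · L1 W4.5c] -/
theorem C_mul_uEight_mem (r : k) : C r * uEight k n a b c d e ∈ I12 k n a b c d ^ 2 :=
  mem_I12_pow_of_lb k n a b c d hab hac had hbc hbd hcd 2 _
    (JordanFour.lb_C_mul W r (lb_uEight k n a b c d e hab hac had hae hbc hbd hbe hcd hce hde))

end Memberships

end Summit.ResolutionOfSingularities.ResolutionOfSingularities.Theorems.WildQuotientResolution.JordanFive

end
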